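import Literature.Analysis.FluidPDE.NSGaldiDualityBounds
import Literature.Analysis.FluidPDE.NSGaldiDivCurlWeak
import Literature.Analysis.FluidPDE.SolenoidalSlabDuality
import Mathlib.Analysis.Normed.Operator.Extend
import Mathlib.MeasureTheory.Measure.SeparableMeasure
import Mathlib.Analysis.Distribution.AEEqOfIntegralContDiff
import HarnessLib

/-!
# The vorticity of an `L⁴(Q_T)` distributional Navier–Stokes solution lies in `L²(Q_T)`;
  the weak gradient

Analysis/FluidPDE support file in the discharge programme of the named fact
`Literature.Analysis.FluidPDE.galdi_energy_equality` (Galdi 2019, Proc. AMS 147, Thm. 1.1), layer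
`Literature.Analysis.FluidPDE.galdi_lerayHopf_class`: this file proves the **`L²(0,T; Ḣ¹)` half**
of the class assertion, in the tree's rendering (a weak gradient `G t` of the slice `v t` for
a.e. `t ∈ (0,T)` with `∫₀ᵀ ∫ |G|² < ∞`):

* `Literature.Analysis.FluidPDE.IsWeakNSSolutionOn.exists_weakGradient_of_L4` (`dim E = 3`):
  for `ν > 0`, `T > 0`, `v` a weak (pressure-free, divergence-free-tested) solution of the
  unforced system on `E × [0,T)` with datum `v₀ ∈ L²` (`IsWeakNSSolutionOn T ν 0 v₀ v`) and
  `v ∈ L⁴` of the slab `(0,T) × E`, there is `G` with `HasWeakGradient (v t) (G t)` for a.e.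
  `t ∈ (0,T)` and `∫₀ᵀ ∫ |G t x|²_F dx dt < ∞`.

The chain of the proof:
1. `IsWeakNSSolutionOn.exists_weakVorticity_memLp_two` — the **space–time weak vorticity is in
   `L²(Q_T)`**: for `a, c ∈ E` the functional `θ ↦ ∫_{Q_T} ⟪v, (∂ₐθ) c - (∂_cθ) a⟫` on the
   test functions of the open slab is bounded by `K ‖θ‖_{L²(Q_T)}` (the `L²(Q_T)` duality bound
   `IsWeakNSSolutionOn.abs_integral_inner_curlPair_le_L2` of `NSGaldiDualityBounds`, i.e. heat
   maximal regularity), so it is represented by some `ω ∈ L²(Q_T)` (Riesz on the closure of the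
   test functions in `L²(Q_T)`, `exists_mem_closure_norm_le_inner_eq` — no density theorem is
   needed);
2. `ae_slice_weakVorticity_eq`, `ae_forall_slice_weakVorticity_eq` — **slicing**: testing with
   products `α(t) β(x)` and the fundamental lemma of the calculus of variations in `t` (Mathlib
   `IsOpen.ae_eq_zero_of_integral_contDiff_smul_eq_zero`) give, for every real test function `β`
   and a.e. `t`, `∫ ω(t) β = ∫ ⟪v(t), (∂ₐβ) c - (∂_cβ) a⟫`; a countable family of test functions
   dense for `‖·‖₂ + ‖D·‖_{4/3} + ‖D·‖₂` (`exists_seq_tests_dense`, from the second countability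
   of `L² × L^{4/3} × L²`) upgrades this to all `β` simultaneously for a.e. `t`;
3. `exists_hasWeakGradient_of_weakVorticity` (`NSGaldiDivCurlWeak`, dimension `3`) — for a.e.
   `t` the slice `v(t) ∈ L⁴` is weakly divergence free with weak vorticities `ω_{ij}(t) ∈ L²`,
   hence has a weak gradient with `∫|∇v(t)|² ≤ ½ Σᵢⱼ ‖ω_{ij}(t)‖₂²`, integrable in `t`.

Supporting lemmas (all proved): the generic Riesz representation on the closure of the range of
a linear map into a Hilbert space; time bounds of test functions on the open slab; convergence
of continuous bilinear pairings under `L^q` convergence (`tendsto_integral_bilin_of_tendsto_eLpNorm`);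
slices of `L^r` functions on products (`ae_memLp_slice_of_memLp_prod`). No new definitions.

## Mathlib / tree search

Mathlib: `LinearMap.extendOfNorm`, `InnerProductSpace.toDual`, `Lp.SecondCountableTopology`,
`TopologicalSpace.exists_countable_dense`, `mem_closure_iff_seq_limit`,
`IsOpen.ae_eq_zero_of_integral_contDiff_smul_eq_zero`, `Integrable.integral_prod_left`,
`eLpNorm_le_eLpNorm_mul_eLpNorm_of_nnnorm`. Tree: `NSGaldiDualityBounds`, `NSGaldiDivCurlWeak`,
`SolenoidalSlabDuality` (`norm_toLp_sq_eq_integral_sq_norm`), `NSGaldiDualityIdentity`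
(`slab_le_volume`, `one_le_four_thirds_and_ne_top`, `IsSpaceTimeTestOn.memLp_slab`),
`NSGaldiExtendedTest`.

## References

* G. P. Galdi, *On the energy equality for distributional solutions to Navier–Stokes equations*,
  Proc. Amer. Math. Soc. 147 (2019), 785–792 (arXiv:1710.05725), Thm. 1.1 and its proof,
  (2.12)–(2.15). Bib key `Galdi2018`.
* H. Sohr, *The Navier–Stokes equations*, Birkhäuser 2001, Ch. V, §1.4 (the class
  `L²(0,T; H¹)`). Bib key `Sohr2001`.
-/

noncomputable section

open MeasureTheory TopologicalSpace Set Function Filter Topology InnerProductSpace Metric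
open scoped RealInnerProductSpace ENNReal NNReal ContDiff

namespace Literature.Analysis.FluidPDE

variable {E : Type*} [NormedAddCommGroup E] [InnerProductSpace ℝ E] [FiniteDimensional ℝ E]
  [MeasurableSpace E] [BorelSpace E]

/-! ### Riesz representation on the closure of the range -/

section Riesz

/-- **Bounded functionals along a linear map into a Hilbert space are represented in the closure of
its range.** If `ι : D → H` is linear into a real Hilbert space and `ℓ : D → ℝ` is linear with
`|ℓ φ| ≤ A ‖ι φ‖`, then some `h` in the closure of the range of `ι`, with `‖h‖ ≤ A`, satisfies
`⟪h, ι φ⟫ = ℓ φ` for all `φ` (extension by continuity to the closure, Mathlib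
`LinearMap.extendOfNorm`, and the Riesz representation theorem there). [folklore] -/
theorem exists_mem_closure_norm_le_inner_eq {V : Type*} [AddCommGroup V] [Module ℝ V]
    {H : Type*} [NormedAddCommGroup H] [InnerProductSpace ℝ H] [CompleteSpace H]
    {D : Submodule ℝ V} (ι : D →ₗ[ℝ] H) (ℓ : D →ₗ[ℝ] ℝ) {A : ℝ} (hA : 0 ≤ A)
    (hℓ : ∀ φ : D, |ℓ φ| ≤ A * ‖ι φ‖) :
    ∃ h : H, h ∈ (LinearMap.range ι).topologicalClosure ∧ ‖h‖ ≤ A ∧ ∀ φ : D, ⟪h, ι φ⟫ = ℓ φ := by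
  set S : Submodule ℝ H := (LinearMap.range ι).topologicalClosure with hS
  haveI : CompleteSpace S := (Submodule.isClosed_topologicalClosure _).completeSpace_coe
  set ι' : D →ₗ[ℝ] S := ι.codRestrict S fun φ =>
    Submodule.le_topologicalClosure _ (LinearMap.mem_range_self ι φ) with hι'
  have hdense : DenseRange ι' := by
    rw [denseRange_iff_closure_range]
    have hemb : IsEmbedding (Subtype.val : S → H) := IsEmbedding.subtypeVal
    rw [eq_univ_iff_forall]
    intro z
    rw [hemb.closure_eq_preimage_closure_image, mem_preimage]
    have himage : Subtype.val '' range ι' = (LinearMap.range ι : Set H) := by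
      ext v
      constructor
      · rintro ⟨w, ⟨φ, rfl⟩, rfl⟩
        exact ⟨φ, rfl⟩
      · rintro ⟨φ, rfl⟩
        exact ⟨ι' φ, ⟨φ, rfl⟩, rfl⟩
    rw [himage, ← Submodule.topologicalClosure_coe]
    exact z.2
  have hℓ' : ∀ φ : D, ‖ℓ φ‖ ≤ A * ‖ι' φ‖ := fun φ => by
    rw [Real.norm_eq_abs]; exact hℓ φ
  set L : S →L[ℝ] ℝ := ℓ.extendOfNorm ι' with hL_def
  have hL_eq : ∀ φ : D, L (ι' φ) = ℓ φ := fun φ => LinearMap.extendOfNorm_eq hdense ⟨A, hℓ'⟩ φ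
  have hL_norm : ‖L‖ ≤ A := LinearMap.opNorm_extendOfNorm_le hdense hA hℓ'
  set h : S := (InnerProductSpace.toDual ℝ S).symm L with hh_def
  have hh_inner : ∀ y : S, ⟪h, y⟫ = L y := fun y => InnerProductSpace.toDual_symm_apply
  have hh_norm : ‖h‖ ≤ A := by
    rw [hh_def, LinearIsometryEquiv.norm_map]; exact hL_norm
  refine ⟨(h : H), h.2, by simpa [Submodule.coe_norm] using hh_norm, fun φ => ?_⟩
  rw [show ι φ = ((ι' φ : S) : H) from rfl, ← Submodule.coe_inner, hh_inner, hL_eq]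

end Riesz

/-! ### Test functions on the open slab -/

section SlabTests

omit [InnerProductSpace ℝ E] [FiniteDimensional ℝ E] [MeasurableSpace E] [BorelSpace E] in
/-- **Time bound of a test function on the open slab.** A test function `θ` on `(0,T) × E`
(`T > 0`) vanishes for `t ≥ b` for some `b < T`. [folklore] -/
theorem exists_time_bound_of_isSpaceTimeTestOn_slab [NormedSpace ℝ E] {T : ℝ} (hT : 0 < T)
    {θ : ℝ → E → ℝ} (hθ : IsSpaceTimeTestOn (slab E (Ioo 0 T) isOpen_Ioo) θ) :
    ∃ b : ℝ, b < T ∧ ∀ t, b ≤ t → θ t = 0 := by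
  set K : Set (ℝ × E) := tsupport (uncurry θ) with hK
  have hKc : IsCompact K := hθ.hasCompactSupport
  have hKsub : ∀ p ∈ K, p.1 ∈ Ioo 0 T := fun p hp => by
    have h := hθ.tsupport_subset hp
    rw [SetLike.mem_coe, mem_slab] at h
    exact h
  by_cases hne : K.Nonempty
  · have hIc : IsCompact (Prod.fst '' K) := hKc.image continuous_fst
    have hIne : (Prod.fst '' K).Nonempty := hne.image _
    set b₀ : ℝ := sSup (Prod.fst '' K) with hb₀
    have hb₀mem : b₀ ∈ Prod.fst '' K := hIc.sSup_mem hIne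
    obtain ⟨p₀, hp₀, hp₀eq⟩ := hb₀mem
    have hb₀T : b₀ < T := by rw [← hp₀eq]; exact (hKsub p₀ hp₀).2
    refine ⟨(b₀ + T) / 2, by linarith, fun t ht => funext fun x => ?_⟩
    by_contra hx
    have hmem : (t, x) ∈ K := subset_tsupport _ hx
    have hle : t ≤ b₀ := le_csSup hIc.bddAbove ⟨(t, x), hmem, rfl⟩
    linarith
  · refine ⟨T / 2, by linarith, fun t _ => funext fun x => ?_⟩
    by_contra hx
    exact hne ⟨(t, x), subset_tsupport _ hx⟩

omit [InnerProductSpace ℝ E] [FiniteDimensional ℝ E] [MeasurableSpace E] [BorelSpace E] in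
/-- Sums of test functions on an open set are test functions. [folklore] -/
theorem _root_.Literature.Analysis.FunctionSpaces.IsTestFunctionOn.add' {X : Type*} [NormedAddCommGroup X]
    [NormedSpace ℝ X] {F : Type*} [NormedAddCommGroup F] [NormedSpace ℝ F] {Ω : Opens X} {φ ψ : X → F}
    (hφ : FunctionSpaces.IsTestFunctionOn Ω φ) (hψ : FunctionSpaces.IsTestFunctionOn Ω ψ) :
    FunctionSpaces.IsTestFunctionOn Ω (φ + ψ) :=
  ⟨hφ.contDiff.add hψ.contDiff, hφ.hasCompactSupport.add hψ.hasCompactSupport,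
    (tsupport_add φ ψ).trans (union_subset hφ.tsupport_subset hψ.tsupport_subset)⟩

omit [InnerProductSpace ℝ E] [FiniteDimensional ℝ E] [MeasurableSpace E] [BorelSpace E] in
/-- Constant multiples of test functions on an open set are test functions. [folklore] -/
theorem _root_.Literature.Analysis.FunctionSpaces.IsTestFunctionOn.const_smul' {X : Type*} [NormedAddCommGroup X]
    [NormedSpace ℝ X] {F : Type*} [NormedAddCommGroup F] [NormedSpace ℝ F] {Ω : Opens X} {φ : X → F}
    (hφ : FunctionSpaces.IsTestFunctionOn Ω φ) (c : ℝ) :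
    FunctionSpaces.IsTestFunctionOn Ω (c • φ) :=
  ⟨contDiff_const.smul hφ.contDiff, hφ.hasCompactSupport.smul_left,
    (tsupport_smul_subset_right (fun _ : X => c) φ).trans hφ.tsupport_subset⟩

end SlabTests

/-! ### The space–time weak vorticity is in `L²(Q_T)` -/

section Vorticity

variable {ν T : ℝ} {v₀ : E → E} {v : ℝ → E → E}

/-- Local notation (as in `NSGaldiExtendedTest`): the linear map `ℓ ↦ ℓ a • c - ℓ c • a`. -/
local notation3 "𝐋[" a ", " c "]" =>
  ((ContinuousLinearMap.apply ℝ ℝ a).smulRight c - (ContinuousLinearMap.apply ℝ ℝ c).smulRight a :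
    (E →L[ℝ] ℝ) →L[ℝ] E)

/-- A test function on the open slab is square integrable for the slab measure. [folklore] -/
theorem memLp_two_slab_of_isTestFunctionOn {T : ℝ} {f : ℝ × E → ℝ}
    (hf : FunctionSpaces.IsTestFunctionOn (slab E (Ioo 0 T) isOpen_Ioo) f) :
    MemLp f 2 ((volume.restrict (Ioo 0 T)).prod (volume : Measure E)) :=
  (hf.contDiff.continuous.memLp_of_hasCompactSupport hf.hasCompactSupport).mono_measure
    (slab_le_volume T)

/-- **The weak vorticity of an `L⁴(Q_T)` distributional solution is in `L²(Q_T)`** (the step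
"`∇v ∈ L²`" of Galdi 2019, Thm. 1.1, at the level of the vorticity). For `ν > 0`, `T > 0`, `v` a
weak solution on `E × [0,T)` with datum `v₀ ∈ L²` lying in `L⁴` of the slab, and `a, c ∈ E`,
there is `ω ∈ L²((0,T) × E)` with
`∫_{(0,T)×E} ω θ = ∫_{(0,T)×E} ⟪v, (∂ₐθ) c - (∂_cθ) a⟫` for every real test function `θ` on the
open slab `(0,T) × E` — by the `L²(Q_T)` duality bound and the Riesz representation theorem on
the closure of the test functions in `L²(Q_T)`. [cite: Galdi2018, proof of Thm. 1.1, (2.12)–(2.15)] -/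
theorem IsWeakNSSolutionOn.exists_weakVorticity_memLp_two (hν : 0 < ν) (hT : 0 < T)
    (hw : IsWeakNSSolutionOn T ν 0 v₀ v) (hv₀ : MemLp v₀ 2 volume)
    (hv4 : eLpNorm (uncurry v) 4 ((volume.restrict (Ioo 0 T)).prod (volume : Measure E)) < ⊤)
    (a c : E) :
    ∃ om : ℝ × E → ℝ, MemLp om 2 ((volume.restrict (Ioo 0 T)).prod (volume : Measure E)) ∧
      ∀ θ : ℝ → E → ℝ, IsSpaceTimeTestOn (slab E (Ioo 0 T) isOpen_Ioo) θ →
        ∫ p, om p * θ p.1 p.2 ∂((volume.restrict (Ioo 0 T)).prod (volume : Measure E)) =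
          ∫ p, ⟪v p.1 p.2, (fderiv ℝ (θ p.1) p.2 a) • c - (fderiv ℝ (θ p.1) p.2 c) • a⟫
            ∂((volume.restrict (Ioo 0 T)).prod (volume : Measure E)) := by
  set μ : Measure (ℝ × E) := (volume.restrict (Ioo 0 T)).prod (volume : Measure E) with hμ
  set Q : Opens (ℝ × E) := slab E (Ioo 0 T) isOpen_Ioo with hQ
  -- the test functions on the open slab as a subspace
  let D : Submodule ℝ (ℝ × E → ℝ) :=
    { carrier := {f | FunctionSpaces.IsTestFunctionOn Q f}
      add_mem' := fun hf hg => hf.add' hg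
      zero_mem' := FunctionSpaces.isTestFunctionOn_zero Q
      smul_mem' := fun c f hf => hf.const_smul' c }
  have hD : ∀ f : D, FunctionSpaces.IsTestFunctionOn Q (f : ℝ × E → ℝ) := fun f => f.2
  have hD2 : ∀ f : D, MemLp (f : ℝ × E → ℝ) 2 μ := fun f => memLp_two_slab_of_isTestFunctionOn (hD f)
  -- the embedding into `L²(μ)`
  set ι : D →ₗ[ℝ] Lp ℝ 2 μ :=
    { toFun := fun f => (hD2 f).toLp (f : ℝ × E → ℝ)
      map_add' := fun f g => by
        have h := MemLp.toLp_add (hD2 f) (hD2 g)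
        exact h.symm ▸ rfl
      map_smul' := fun c f => by
        have h := MemLp.toLp_const_smul c (hD2 f)
        exact h.symm ▸ rfl } with hι_def
  -- the vorticity functional
  have hV4 : MemLp (uncurry v) 4 μ := ⟨aestronglyMeasurable_uncurry_prod_of_restrict hw.1, hv4⟩
  have htest : ∀ f : D, IsSpaceTimeTestOn (⊤ : Opens (ℝ × E)) (fun t x => (f : ℝ × E → ℝ) (t, x)) :=
    fun f => (hD f).mono le_top
  have hcp : ∀ f : D, IsSpaceTimeTestOn (⊤ : Opens (ℝ × E))
      (fun t x => 𝐋[a, c] (fderiv ℝ (fun y => (f : ℝ × E → ℝ) (t, y)) x)) := fun f =>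
    (htest f).fderiv_top.clm_apply_top 𝐋[a, c]
  have hint : ∀ f : D, Integrable (fun p : ℝ × E =>
      ⟪uncurry v p, 𝐋[a, c] (fderiv ℝ (fun y => (f : ℝ × E → ℝ) (p.1, y)) p.2)⟫) μ := fun f =>
    integrable_inner_of_memLp_four_fourThirds hV4 ((hcp f).memLp_slab (4 / 3) T (fun _ => rfl))
  set ℓ : D →ₗ[ℝ] ℝ :=
    { toFun := fun f => ∫ p, ⟪uncurry v p, 𝐋[a, c] (fderiv ℝ (fun y => (f : ℝ × E → ℝ) (p.1, y)) p.2)⟫ ∂μ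
      map_add' := fun f g => by
        rw [← integral_add (hint f) (hint g)]
        refine integral_congr_ae (Eventually.of_forall fun p => ?_)
        dsimp only
        rw [← inner_add_right, ← map_add]
        congr 2
        simp only [Submodule.coe_add]
        exact fderiv_add (((hD f).contDiff.comp (contDiff_prodMk_right p.1)).differentiable
          (by simp) p.2) (((hD g).contDiff.comp (contDiff_prodMk_right p.1)).differentiable (by simp) p.2)
      map_smul' := fun r f => by
        rw [RingHom.id_apply, smul_eq_mul, ← integral_const_mul]
        refine integral_congr_ae (Eventually.of_forall fun p => ?_)
        dsimp only
        rw [← real_inner_smul_right, ← map_smul]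
        congr 2
        simp only [Submodule.coe_smul]
        exact fderiv_const_smul (((hD f).contDiff.comp (contDiff_prodMk_right p.1)).differentiable
          (by simp) p.2) r } with hℓ_def
  -- the bound from the `L²(Q_T)` duality estimate
  set K : ℝ := 2 * ‖a‖ * ‖c‖ * (Real.sqrt (Module.finrank ℝ E) / ν * Real.sqrt (∫ p, ‖v p.1 p.2‖ ^ 4 ∂μ) +
    Real.sqrt (2 * Module.finrank ℝ E / ν) * Real.sqrt (∫ x, ‖v₀ x‖ ^ 2)) with hK
  have hK0 : 0 ≤ K := by positivity
  have hbound : ∀ f : D, |ℓ f| ≤ K * ‖ι f‖ := fun f => by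
    obtain ⟨b, hbT, hb⟩ := exists_time_bound_of_isSpaceTimeTestOn_slab hT (θ := fun t x => (f : ℝ × E → ℝ) (t, x)) (hD f)
    have h := hw.abs_integral_inner_curlPair_le_L2 hν hT hv₀ hv4 (htest f) hbT hb a c
      (Φ := fun t x => 𝐋[a, c] (fderiv ℝ (fun y => (f : ℝ × E → ℝ) (t, y)) x)) (fun t x => by simp)
    have hnorm : ‖ι f‖ = Real.sqrt (∫ p, ‖(f : ℝ × E → ℝ) (p.1, p.2)‖ ^ 2 ∂μ) := by
      rw [← Real.sqrt_sq (norm_nonneg (ι f)), show ι f = (hD2 f).toLp (f : ℝ × E → ℝ) from rfl,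
        norm_toLp_sq_eq_integral_sq_norm (hD2 f)]
    rw [hnorm]
    exact h
  -- Riesz
  obtain ⟨h, -, -, hh⟩ := exists_mem_closure_norm_le_inner_eq ι ℓ hK0 hbound
  refine ⟨(h : ℝ × E → ℝ), Lp.memLp h, fun θ hθ => ?_⟩
  have hθD : uncurry θ ∈ D := hθ
  have h1 := hh ⟨uncurry θ, hθD⟩
  rw [show ι ⟨uncurry θ, hθD⟩ = (hD2 ⟨uncurry θ, hθD⟩).toLp (uncurry θ) from rfl, L2.inner_def] at h1
  have hlhs : ∫ p, (h : ℝ × E → ℝ) p * θ p.1 p.2 ∂μ =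
      ∫ p, ⟪(h : ℝ × E → ℝ) p, ((hD2 ⟨uncurry θ, hθD⟩).toLp (uncurry θ) : ℝ × E → ℝ) p⟫ ∂μ := by
    refine integral_congr_ae ?_
    filter_upwards [(hD2 ⟨uncurry θ, hθD⟩).coeFn_toLp] with p hp
    rw [hp]
    simp [uncurry, mul_comm]
  rw [hlhs, h1]
  simp only [hℓ_def, LinearMap.coe_mk, AddHom.coe_mk]
  rfl

end Vorticity

/-! ### Slicing the space–time identity -/

section Slicing

variable {T : ℝ}

omit [InnerProductSpace ℝ E] [FiniteDimensional ℝ E] [MeasurableSpace E] [BorelSpace E] in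
/-- **Product test functions on the open slab**: `α(t) β(x)` with `α` smooth, compactly supported
in `(0, T)`, and `β` a test function on `E`. [folklore] -/
theorem isSpaceTimeTestOn_slab_mul [NormedSpace ℝ E] {α : ℝ → ℝ} (hα : ContDiff ℝ ∞ α)
    (hαc : HasCompactSupport α) (hαT : tsupport α ⊆ Ioo 0 T) {β : E → ℝ}
    (hβ : FunctionSpaces.IsTestFunctionOn (⊤ : Opens E) β) :
    IsSpaceTimeTestOn (slab E (Ioo 0 T) isOpen_Ioo) (fun t x => α t * β x) := by
  have hsub : tsupport (uncurry fun t x => α t * β x) ⊆ tsupport α ×ˢ tsupport β := by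
    refine closure_minimal (fun p hp => ?_) ((isClosed_tsupport _).prod (isClosed_tsupport _))
    rw [mem_support] at hp
    constructor
    · exact subset_tsupport _ (fun h => hp (by simp [uncurry, h]))
    · exact subset_tsupport _ (fun h => hp (by simp [uncurry, h]))
  refine ⟨(hα.comp contDiff_fst).mul (hβ.contDiff.comp contDiff_snd), ?_, ?_⟩
  · exact IsCompact.of_isClosed_subset (hαc.prod hβ.hasCompactSupport) (isClosed_tsupport _) hsub
  · intro p hp
    rw [SetLike.mem_coe, mem_slab]
    exact hαT (hsub hp).1

/-- A function of the space variable in `L^r(E)` is in `L^r` of the slab `(0,T) × E`. [folklore] -/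
theorem memLp_slab_comp_snd {G : Type*} [NormedAddCommGroup G] {g : E → G} {r : ℝ≥0∞}
    (hg : MemLp g r (volume : Measure E)) (T : ℝ) :
    MemLp (fun q : ℝ × E => g q.2) r ((volume.restrict (Ioo 0 T)).prod (volume : Measure E)) := by
  set μ : Measure (ℝ × E) := (volume.restrict (Ioo 0 T)).prod (volume : Measure E) with hμ
  have hm : AEStronglyMeasurable (fun q : ℝ × E => g q.2) μ := hg.1.comp_snd
  refine ⟨hm, ?_⟩
  by_cases hr0 : r = 0
  · simp [hr0]
  by_cases hrt : r = ⊤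
  · subst hrt
    rw [eLpNorm_exponent_top]
    have h2 := hg.2
    rw [eLpNorm_exponent_top] at h2
    refine lt_of_le_of_lt (eLpNormEssSup_le_of_ae_enorm_bound ?_) h2
    have hae : ∀ᵐ x ∂(volume : Measure E), ‖g x‖ₑ ≤ eLpNormEssSup g volume := ae_le_eLpNormEssSup
    exact (Measure.quasiMeasurePreserving_snd (μ := volume.restrict (Ioo 0 T))
      (ν := (volume : Measure E))).ae hae
  · rw [eLpNorm_lt_top_iff_lintegral_rpow_enorm_lt_top hr0 hrt, hμ,
      lintegral_prod _ (hm.enorm.pow_const _)]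
    simp only [lintegral_const, Measure.restrict_apply_univ]
    exact ENNReal.mul_lt_top (lintegral_rpow_enorm_lt_top_of_eLpNorm_lt_top hr0 hrt hg.2)
      (by rw [Real.volume_Ioo]; exact ENNReal.ofReal_lt_top)

variable {v : ℝ → E → E} {om : ℝ × E → ℝ} {a c : E}

/-- **Slicing the weak-vorticity identity.** If `ω ∈ L²` and `v ∈ L⁴` of the slab satisfy
`∫ ω θ = ∫ ⟪v, (∂ₐθ) c - (∂_cθ) a⟫` for all test functions `θ` on the open slab, then for every
real test function `β` on `E` and a.e. `t ∈ (0, T)`: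
`∫ ω(t, x) β(x) dx = ∫ ⟪v(t, x), (∂ₐβ)(x) c - (∂_cβ)(x) a⟫ dx` (product tests `α(t) β(x)` and the
fundamental lemma of the calculus of variations in `t`). [folklore] -/
theorem ae_slice_weakVorticity_eq
    (hv : MemLp (uncurry v) 4 ((volume.restrict (Ioo 0 T)).prod (volume : Measure E)))
    (hom : MemLp om 2 ((volume.restrict (Ioo 0 T)).prod (volume : Measure E)))
    (hid : ∀ θ : ℝ → E → ℝ, IsSpaceTimeTestOn (slab E (Ioo 0 T) isOpen_Ioo) θ →
      ∫ p, om p * θ p.1 p.2 ∂((volume.restrict (Ioo 0 T)).prod (volume : Measure E)) =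
        ∫ p, ⟪v p.1 p.2, (fderiv ℝ (θ p.1) p.2 a) • c - (fderiv ℝ (θ p.1) p.2 c) • a⟫
          ∂((volume.restrict (Ioo 0 T)).prod (volume : Measure E)))
    {β : E → ℝ} (hβ : FunctionSpaces.IsTestFunctionOn (⊤ : Opens E) β) :
    ∀ᵐ t ∂(volume.restrict (Ioo 0 T)), ∫ x, om (t, x) * β x =
      ∫ x, ⟪v t x, (fderiv ℝ β x a) • c - (fderiv ℝ β x c) • a⟫ := by
  set μ : Measure (ℝ × E) := (volume.restrict (Ioo 0 T)).prod (volume : Measure E) with hμ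
  set cpβ : E → E := fun x => (fderiv ℝ β x a) • c - (fderiv ℝ β x c) • a with hcpβ
  have hcpβc : Continuous cpβ :=
    (((hβ.contDiff.continuous_fderiv (by simp)).clm_apply continuous_const).smul continuous_const).sub
      (((hβ.contDiff.continuous_fderiv (by simp)).clm_apply continuous_const).smul continuous_const)
  have hcpβs : HasCompactSupport cpβ :=
    ((hβ.hasCompactSupport.fderiv_apply (𝕜 := ℝ) a).smul_right).sub
      ((hβ.hasCompactSupport.fderiv_apply (𝕜 := ℝ) c).smul_right)
  have hcpβm : ∀ r : ℝ≥0∞, MemLp cpβ r (volume : Measure E) := fun r =>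
    hcpβc.memLp_of_hasCompactSupport hcpβs
  have hβm : ∀ r : ℝ≥0∞, MemLp β r (volume : Measure E) := fun r =>
    hβ.contDiff.continuous.memLp_of_hasCompactSupport hβ.hasCompactSupport
  -- the two slice functionals and their integrability in time
  have iA : Integrable (fun p : ℝ × E => om p * β p.2) μ :=
    hom.integrable_mul (memLp_slab_comp_snd (hβm 2) T)
  have iB : Integrable (fun p : ℝ × E => ⟪uncurry v p, cpβ p.2⟫) μ :=
    integrable_inner_of_memLp_four_fourThirds hv (memLp_slab_comp_snd (hcpβm (4 / 3)) T)
  set F : ℝ → ℝ := fun t => (∫ x, om (t, x) * β x) - ∫ x, ⟪v t x, cpβ x⟫ with hF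
  have hFi : Integrable F (volume.restrict (Ioo 0 T)) := by
    have h1 := iA.integral_prod_left
    have h2 := iB.integral_prod_left
    exact h1.sub h2
  -- testing against `α(t)`
  have hzero : ∀ α : ℝ → ℝ, ContDiff ℝ ∞ α → HasCompactSupport α → tsupport α ⊆ Ioo 0 T →
      ∫ t, α t • F t = 0 := by
    intro α hα hαc hαT
    have hθ := isSpaceTimeTestOn_slab_mul hα hαc hαT hβ
    have h := hid _ hθ
    -- the left integral
    have hαb : ∃ C, ∀ t, ‖α t‖ ≤ C := hα.continuous.bounded_above_of_compact_support hαc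
    obtain ⟨C, hC⟩ := hαb
    have iAα : Integrable (fun p : ℝ × E => om p * (α p.1 * β p.2)) μ := by
      refine (iA.norm.const_mul C).mono' ?_ (Eventually.of_forall fun p => ?_)
      · exact hom.1.mul ((hα.continuous.comp continuous_fst).aestronglyMeasurable.mul
          ((hβ.contDiff.continuous.comp continuous_snd).aestronglyMeasurable))
      · rw [norm_mul, norm_mul, norm_mul]
        calc ‖om p‖ * (‖α p.1‖ * ‖β p.2‖) = ‖α p.1‖ * (‖om p‖ * ‖β p.2‖) := by ring
          _ ≤ C * (‖om p‖ * ‖β p.2‖) := by gcongr; exact hC _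
    have hL : ∫ p, om p * (α p.1 * β p.2) ∂μ = ∫ t in Ioo 0 T, α t * ∫ x, om (t, x) * β x := by
      rw [hμ, integral_prod _ iAα]
      refine integral_congr_ae (Eventually.of_forall fun t => ?_)
      dsimp only
      rw [← integral_const_mul]
      exact integral_congr_ae (Eventually.of_forall fun x => by ring)
    -- the right integral
    have hcpθ : ∀ t x, (fderiv ℝ (fun y => α t * β y) x a) • c - (fderiv ℝ (fun y => α t * β y) x c) • a =
        α t • cpβ x := fun t x => by
      have hd : fderiv ℝ (fun y => α t * β y) x = α t • fderiv ℝ β x :=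
        fderiv_const_mul ((hβ.contDiff.differentiable (by simp)) x) (α t)
      rw [hd]
      simp only [hcpβ, FunLike.coe_smul, Pi.smul_apply, smul_eq_mul, smul_sub, smul_smul]
    have iBα : Integrable (fun p : ℝ × E => ⟪v p.1 p.2, α p.1 • cpβ p.2⟫) μ := by
      refine (iB.norm.const_mul C).mono' ?_ (Eventually.of_forall fun p => ?_)
      · exact hv.1.inner (((hα.continuous.comp continuous_fst).aestronglyMeasurable).smul
          ((hcpβc.comp continuous_snd).aestronglyMeasurable))
      · rw [real_inner_smul_right, norm_mul]
        exact mul_le_mul_of_nonneg_right (hC _) (norm_nonneg _)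
    have hR : ∫ p, ⟪v p.1 p.2, (fderiv ℝ (fun y => α p.1 * β y) p.2 a) • c -
        (fderiv ℝ (fun y => α p.1 * β y) p.2 c) • a⟫ ∂μ = ∫ t in Ioo 0 T, α t * ∫ x, ⟪v t x, cpβ x⟫ := by
      simp_rw [hcpθ]
      rw [hμ, integral_prod _ iBα]
      refine integral_congr_ae (Eventually.of_forall fun t => ?_)
      dsimp only
      rw [← integral_const_mul]
      exact integral_congr_ae (Eventually.of_forall fun x => by dsimp only; rw [real_inner_smul_right])
    -- assemble
    have hsupp : ∀ t, t ∉ Ioo 0 T → α t • F t = 0 := fun t ht => by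
      rw [image_eq_zero_of_notMem_tsupport (fun h => ht (hαT h)), zero_smul]
    have i1 : Integrable (fun t => α t * ∫ x, om (t, x) * β x) (volume.restrict (Ioo 0 T)) :=
      iA.integral_prod_left.bdd_mul hα.continuous.aestronglyMeasurable (Eventually.of_forall fun t => hC t)
    have i2 : Integrable (fun t => α t * ∫ x, ⟪v t x, cpβ x⟫) (volume.restrict (Ioo 0 T)) :=
      iB.integral_prod_left.bdd_mul hα.continuous.aestronglyMeasurable (Eventually.of_forall fun t => hC t)
    rw [← setIntegral_eq_integral_of_forall_compl_eq_zero (s := Ioo 0 T) (fun t ht => hsupp t ht)]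
    simp only [hF, smul_eq_mul, mul_sub]
    rw [integral_sub i1 i2, ← hL, ← hR, h, sub_self]
  have hFi' : IntegrableOn F (Ioo 0 T) volume := hFi
  have hae := (isOpen_Ioo (a := (0 : ℝ)) (b := T)).ae_eq_zero_of_integral_contDiff_smul_eq_zero
    hFi'.locallyIntegrableOn hzero
  rw [ae_restrict_iff' measurableSet_Ioo]
  filter_upwards [hae] with t ht htm
  exact sub_eq_zero.1 (ht htm)

end Slicing

/-! ### A countable family of test functions dense for the relevant norms -/

section CountableDense

/-- Norm convergence of `L^p` classes is `eLpNorm` convergence of the representatives. [folklore] -/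
theorem tendsto_eLpNorm_of_tendsto_toLp {α : Type*} [MeasurableSpace α] {μ : Measure α}
    {G : Type*} [NormedAddCommGroup G] {p : ℝ≥0∞} [Fact (1 ≤ p)] {f : ℕ → α → G} {g : α → G}
    (hf : ∀ n, MemLp (f n) p μ) (hg : MemLp g p μ)
    (h : Tendsto (fun n => (hf n).toLp (f n)) atTop (𝓝 (hg.toLp g))) :
    Tendsto (fun n => eLpNorm (f n - g) p μ) atTop (𝓝 0) := by
  rw [tendsto_iff_norm_sub_tendsto_zero] at h
  have heq : ∀ n, ‖(hf n).toLp (f n) - hg.toLp g‖ = (eLpNorm (f n - g) p μ).toReal := fun n => by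
    rw [← MemLp.toLp_sub (hf n) hg, Lp.norm_toLp]
  simp_rw [heq] at h
  have hne : ∀ n, eLpNorm (f n - g) p μ ≠ ⊤ := fun n => ((hf n).sub hg).eLpNorm_ne_top
  exact (ENNReal.tendsto_toReal_iff hne ENNReal.zero_ne_top).1 (by simpa using h)

/-- **A countable family of real test functions dense for `‖·‖₂ + ‖D·‖_{4/3} + ‖D·‖₂`.** There is
a sequence of test functions `𝔅ₙ` on `E` such that every test function `β` is the limit of a
subsequence `𝔅_{κ k}` with `𝔅_{κ k} → β` in `L²`, `D𝔅_{κ k} → Dβ` in `L^{4/3}` and in `L²`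
(the image of the test functions in the second-countable space `L² × L^{4/3} × L²` is separable). [folklore] -/
theorem exists_seq_tests_dense :
    ∃ 𝔅 : ℕ → (E → ℝ), (∀ n, FunctionSpaces.IsTestFunctionOn (⊤ : Opens E) (𝔅 n)) ∧
      ∀ β : E → ℝ, FunctionSpaces.IsTestFunctionOn (⊤ : Opens E) β → ∃ κ : ℕ → ℕ,
        Tendsto (fun k => eLpNorm (𝔅 (κ k) - β) 2 (volume : Measure E)) atTop (𝓝 0) ∧
        Tendsto (fun k => eLpNorm (fun x => fderiv ℝ (𝔅 (κ k)) x - fderiv ℝ β x) (4 / 3)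
          (volume : Measure E)) atTop (𝓝 0) ∧
        Tendsto (fun k => eLpNorm (fun x => fderiv ℝ (𝔅 (κ k)) x - fderiv ℝ β x) 2
          (volume : Measure E)) atTop (𝓝 0) := by
  haveI h43a : Fact ((1 : ℝ≥0∞) ≤ 4 / 3) := ⟨one_le_four_thirds_and_ne_top.1⟩
  haveI h43b : Fact ((4 / 3 : ℝ≥0∞) ≠ ⊤) := ⟨one_le_four_thirds_and_ne_top.2⟩
  haveI h2b : Fact ((2 : ℝ≥0∞) ≠ ⊤) := ⟨ENNReal.ofNat_ne_top⟩
  -- the test functions and their classes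
  set Tst : Type _ := {β : E → ℝ // FunctionSpaces.IsTestFunctionOn (⊤ : Opens E) β} with hTst
  have hm0 : ∀ β : Tst, MemLp (β : E → ℝ) 2 (volume : Measure E) := fun β =>
    β.2.contDiff.continuous.memLp_of_hasCompactSupport β.2.hasCompactSupport
  have hm1 : ∀ (β : Tst) (r : ℝ≥0∞), MemLp (fderiv ℝ (β : E → ℝ)) r (volume : Measure E) := fun β r =>
    (β.2.contDiff.continuous_fderiv (by simp)).memLp_of_hasCompactSupport (β.2.hasCompactSupport.fderiv (𝕜 := ℝ))
  set X := Lp ℝ 2 (volume : Measure E) × (Lp (E →L[ℝ] ℝ) (4 / 3) (volume : Measure E) ×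
    Lp (E →L[ℝ] ℝ) 2 (volume : Measure E)) with hX
  set Φ : Tst → X := fun β => ((hm0 β).toLp (β : E → ℝ), (hm1 β (4 / 3)).toLp (fderiv ℝ (β : E → ℝ)),
    (hm1 β 2).toLp (fderiv ℝ (β : E → ℝ))) with hΦ
  -- a countable dense subset of the range
  haveI i1 : SecondCountableTopology (Lp ℝ 2 (volume : Measure E)) := inferInstance
  haveI i2 : SecondCountableTopology (Lp (E →L[ℝ] ℝ) (4 / 3) (volume : Measure E)) := inferInstance
  haveI i3 : SecondCountableTopology (Lp (E →L[ℝ] ℝ) 2 (volume : Measure E)) := inferInstance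
  haveI : SecondCountableTopology X := instSecondCountableTopologyProd
  set R : Set X := range Φ with hR
  haveI : Nonempty R := ⟨⟨Φ ⟨0, FunctionSpaces.isTestFunctionOn_zero _⟩, ⟨_, rfl⟩⟩⟩
  obtain ⟨s, hsc, hsd⟩ := TopologicalSpace.exists_countable_dense R
  have hsne : s.Nonempty := hsd.nonempty
  obtain ⟨f, hf⟩ := hsc.exists_eq_range hsne
  have hpre : ∀ y : R, ∃ β : Tst, Φ β = y := fun y => y.2
  choose g hg using hpre
  refine ⟨fun n => (g (f n) : E → ℝ), fun n => (g (f n)).2, fun β hβ => ?_⟩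
  -- approximate `β`
  set y₀ : R := ⟨Φ ⟨β, hβ⟩, ⟨_, rfl⟩⟩ with hy₀
  have hy₀c : y₀ ∈ closure s := by rw [hsd.closure_eq]; trivial
  obtain ⟨u, hus, hu⟩ := mem_closure_iff_seq_limit.1 hy₀c
  have hκ : ∀ k, ∃ m, f m = u k := fun k => by
    have h := hus k
    rw [hf] at h
    exact h
  choose κ hκ using hκ
  refine ⟨κ, ?_⟩
  -- `Φ (𝔅 (κ k)) → Φ β` in `X`
  have hval : Tendsto (fun k => ((u k : R) : X)) atTop (𝓝 ((y₀ : R) : X)) :=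
    (continuous_subtype_val.tendsto y₀).comp hu
  have hΦk : ∀ k, Φ (g (f (κ k))) = ((u k : R) : X) := fun k => by rw [hg, hκ]
  have hlim : Tendsto (fun k => Φ (g (f (κ k)))) atTop (𝓝 (Φ ⟨β, hβ⟩)) := by
    simp_rw [hΦk]; exact hval
  refine ⟨?_, ?_, ?_⟩
  · have h1 : Tendsto (fun k => (Φ (g (f (κ k)))).1) atTop (𝓝 (Φ ⟨β, hβ⟩).1) :=
      (continuous_fst.tendsto _).comp hlim
    exact tendsto_eLpNorm_of_tendsto_toLp (fun k => hm0 (g (f (κ k)))) (hm0 ⟨β, hβ⟩) h1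
  · have h1 : Tendsto (fun k => (Φ (g (f (κ k)))).2.1) atTop (𝓝 (Φ ⟨β, hβ⟩).2.1) :=
      (continuous_fst.tendsto _).comp ((continuous_snd.tendsto _).comp hlim)
    have h2 := tendsto_eLpNorm_of_tendsto_toLp (fun k => hm1 (g (f (κ k))) (4 / 3)) (hm1 ⟨β, hβ⟩ (4 / 3)) h1
    exact h2
  · have h1 : Tendsto (fun k => (Φ (g (f (κ k)))).2.2) atTop (𝓝 (Φ ⟨β, hβ⟩).2.2) :=
      (continuous_snd.tendsto _).comp ((continuous_snd.tendsto _).comp hlim)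
    have h2 := tendsto_eLpNorm_of_tendsto_toLp (fun k => hm1 (g (f (κ k))) 2) (hm1 ⟨β, hβ⟩ 2) h1
    exact h2

end CountableDense

/-! ### Pairings under `L^q` convergence of the second argument -/

section Pairing2

variable {α : Type*} [MeasurableSpace α] {μ : Measure α}
variable {F₁ F₂ : Type*} [NormedAddCommGroup F₁] [NormedSpace ℝ F₁] [NormedAddCommGroup F₂]
  [NormedSpace ℝ F₂]

/-- A continuous bilinear pairing of an `L^p` and an `L^q` function, `1/p + 1/q = 1`, is
integrable. [folklore] -/
theorem integrable_bilin_of_memLp_holder {p q : ℝ≥0∞} [ENNReal.HolderTriple p q 1] (B : F₁ →L[ℝ] F₂ →L[ℝ] ℝ)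
    {f : α → F₁} {g : α → F₂} (hf : MemLp f p μ) (hg : MemLp g q μ) :
    Integrable (fun x => B (f x) (g x)) μ := by
  refine ((hf.norm.integrable_mul hg.norm).const_mul ‖B‖).mono' (B.aestronglyMeasurable_comp₂ hf.1 hg.1)
    (Eventually.of_forall fun x => ?_)
  calc ‖B (f x) (g x)‖ ≤ ‖B‖ * ‖f x‖ * ‖g x‖ := B.le_opNorm₂ _ _
    _ = ‖B‖ * (‖f x‖ * ‖g x‖) := by ring
    _ = ‖B‖ * ((fun x => ‖f x‖) * fun x => ‖g x‖) x := rfl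

/-- **`L^q` convergence of the second argument gives convergence of the pairings** with a fixed
`L^p` function, `1/p + 1/q = 1`. [folklore] -/
theorem tendsto_integral_bilin_of_tendsto_eLpNorm {p q : ℝ≥0∞} [ENNReal.HolderTriple p q 1]
    (B : F₁ →L[ℝ] F₂ →L[ℝ] ℝ) {f : α → F₁} {g : ℕ → α → F₂} {g₀ : α → F₂}
    (hf : MemLp f p μ) (hg : ∀ n, MemLp (g n) q μ) (hg₀ : MemLp g₀ q μ)
    (h : Tendsto (fun n => eLpNorm (g n - g₀) q μ) atTop (𝓝 0)) :
    Tendsto (fun n => ∫ x, B (f x) (g n x) ∂μ) atTop (𝓝 (∫ x, B (f x) (g₀ x) ∂μ)) := by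
  have hbound : ∀ n, edist (∫ x, B (f x) (g n x) ∂μ) (∫ x, B (f x) (g₀ x) ∂μ) ≤
      ‖B‖₊ * eLpNorm f p μ * eLpNorm (g n - g₀) q μ := fun n => by
    rw [edist_eq_enorm_sub, ← integral_sub (integrable_bilin_of_memLp_holder B hf (hg n))
      (integrable_bilin_of_memLp_holder B hf hg₀)]
    have heq : (fun x => B (f x) (g n x) - B (f x) (g₀ x)) = fun x => B (f x) ((g n - g₀) x) := by
      funext x; rw [Pi.sub_apply, map_sub]
    rw [heq]
    refine (enorm_integral_le_lintegral_enorm _).trans ?_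
    rw [← eLpNorm_one_eq_lintegral_enorm]
    exact eLpNorm_le_eLpNorm_mul_eLpNorm_of_nnnorm hf.1 ((hg n).sub hg₀).1 (fun u w => B u w) ‖B‖₊
      (Eventually.of_forall fun x => by exact_mod_cast B.le_opNorm₂ (f x) ((g n - g₀) x))
  have hlim : Tendsto (fun n => (‖B‖₊ : ℝ≥0∞) * eLpNorm f p μ * eLpNorm (g n - g₀) q μ) atTop (𝓝 0) := by
    have := ENNReal.Tendsto.const_mul h (a := (‖B‖₊ : ℝ≥0∞) * eLpNorm f p μ)
      (Or.inr (ENNReal.mul_ne_top ENNReal.coe_ne_top hf.eLpNorm_ne_top))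
    rwa [mul_zero] at this
  rw [tendsto_iff_edist_tendsto_0]
  exact tendsto_of_tendsto_of_tendsto_of_le_of_le tendsto_const_nhds hlim (fun _ => zero_le) hbound

end Pairing2

/-! ### The slice identities for all test functions, almost everywhere in time -/

section AllTests

variable {T : ℝ} {v : ℝ → E → E} {om : ℝ × E → ℝ} {a c : E}

/-- Local notation (as in `NSGaldiExtendedTest`): the linear map `ℓ ↦ ℓ a • c - ℓ c • a`. -/
local notation3 "𝐋'[" a ", " c "]" =>
  ((ContinuousLinearMap.apply ℝ ℝ a).smulRight c - (ContinuousLinearMap.apply ℝ ℝ c).smulRight a :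
    (E →L[ℝ] ℝ) →L[ℝ] E)

/-- The curl-type field of a real test function is in every `L^r`. [folklore] -/
theorem memLp_curlPair_of_isTestFunctionOn {β : E → ℝ} (hβ : FunctionSpaces.IsTestFunctionOn (⊤ : Opens E) β)
    (a c : E) (r : ℝ≥0∞) :
    MemLp (fun x => (fderiv ℝ β x a) • c - (fderiv ℝ β x c) • a) r (volume : Measure E) := by
  have heq : (fun x => (fderiv ℝ β x a) • c - (fderiv ℝ β x c) • a) = fun x => 𝐋'[a, c] (fderiv ℝ β x) := by
    funext x; simp
  rw [heq]
  exact ((𝐋'[a, c]).continuous.comp (hβ.contDiff.continuous_fderiv (by simp))).memLp_of_hasCompactSupport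
    ((hβ.hasCompactSupport.fderiv (𝕜 := ℝ)).comp_left (map_zero _))

/-- **All slice identities at once.** Under the hypotheses of `ae_slice_weakVorticity_eq` and if
in addition the slices `v(t) ∈ L⁴`, `ω(t, ·) ∈ L²` for a.e. `t`, then for a.e. `t ∈ (0, T)` the
identity `∫ ω(t, x) β(x) dx = ∫ ⟪v(t, x), (∂ₐβ) c - (∂_cβ) a⟫ dx` holds for **every** real test
function `β` (countable dense family and continuity of both sides in `β`). [folklore] -/
theorem ae_forall_slice_weakVorticity_eq
    (hv : MemLp (uncurry v) 4 ((volume.restrict (Ioo 0 T)).prod (volume : Measure E)))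
    (hom : MemLp om 2 ((volume.restrict (Ioo 0 T)).prod (volume : Measure E)))
    (hid : ∀ θ : ℝ → E → ℝ, IsSpaceTimeTestOn (slab E (Ioo 0 T) isOpen_Ioo) θ →
      ∫ p, om p * θ p.1 p.2 ∂((volume.restrict (Ioo 0 T)).prod (volume : Measure E)) =
        ∫ p, ⟪v p.1 p.2, (fderiv ℝ (θ p.1) p.2 a) • c - (fderiv ℝ (θ p.1) p.2 c) • a⟫
          ∂((volume.restrict (Ioo 0 T)).prod (volume : Measure E)))
    (hv4 : ∀ᵐ t ∂(volume.restrict (Ioo 0 T)), MemLp (v t) 4 (volume : Measure E))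
    (hom2 : ∀ᵐ t ∂(volume.restrict (Ioo 0 T)), MemLp (fun x => om (t, x)) 2 (volume : Measure E)) :
    ∀ᵐ t ∂(volume.restrict (Ioo 0 T)), ∀ β : E → ℝ, FunctionSpaces.IsTestFunctionOn (⊤ : Opens E) β →
      ∫ x, om (t, x) * β x = ∫ x, ⟪v t x, (fderiv ℝ β x a) • c - (fderiv ℝ β x c) • a⟫ := by
  haveI := holderTriple_four_fourThirds
  obtain ⟨𝔅, h𝔅, hdense⟩ := exists_seq_tests_dense (E := E)
  have hall : ∀ᵐ t ∂(volume.restrict (Ioo 0 T)), ∀ n, ∫ x, om (t, x) * 𝔅 n x =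
      ∫ x, ⟪v t x, (fderiv ℝ (𝔅 n) x a) • c - (fderiv ℝ (𝔅 n) x c) • a⟫ :=
    ae_all_iff.2 fun n => ae_slice_weakVorticity_eq hv hom hid (h𝔅 n)
  filter_upwards [hall, hv4, hom2] with t ht h4 h2 β hβ
  obtain ⟨κ, hκ2, hκ43, -⟩ := hdense β hβ
  have hβm : MemLp β 2 (volume : Measure E) := hβ.contDiff.continuous.memLp_of_hasCompactSupport hβ.hasCompactSupport
  have h𝔅m : ∀ n, MemLp (𝔅 n) 2 (volume : Measure E) := fun n =>
    (h𝔅 n).contDiff.continuous.memLp_of_hasCompactSupport (h𝔅 n).hasCompactSupport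
  -- the left-hand sides converge
  have hL : Tendsto (fun k => ∫ x, om (t, x) * 𝔅 (κ k) x) atTop (𝓝 (∫ x, om (t, x) * β x)) := by
    have h := tendsto_integral_bilin_of_tendsto_eLpNorm (p := 2) (q := 2) (ContinuousLinearMap.mul ℝ ℝ) h2
      (fun k => h𝔅m (κ k)) hβm hκ2
    simpa using h
  -- the right-hand sides converge
  set cp : (E → ℝ) → E → E := fun f x => (fderiv ℝ f x a) • c - (fderiv ℝ f x c) • a with hcp
  have hcpm : ∀ {f : E → ℝ}, FunctionSpaces.IsTestFunctionOn (⊤ : Opens E) f → MemLp (cp f) (4 / 3) (volume : Measure E) :=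
    fun hf => memLp_curlPair_of_isTestFunctionOn hf a c _
  have hcpconv : Tendsto (fun k => eLpNorm (cp (𝔅 (κ k)) - cp β) (4 / 3) (volume : Measure E)) atTop (𝓝 0) := by
    have hle : ∀ k, eLpNorm (cp (𝔅 (κ k)) - cp β) (4 / 3) (volume : Measure E) ≤
        ‖𝐋'[a, c]‖₊ • eLpNorm (fun x => fderiv ℝ (𝔅 (κ k)) x - fderiv ℝ β x) (4 / 3) (volume : Measure E) :=
      fun k => by
      refine eLpNorm_le_nnreal_smul_eLpNorm_of_ae_le_mul (Eventually.of_forall fun x => ?_) _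
      have heq : (cp (𝔅 (κ k)) - cp β) x = 𝐋'[a, c] (fderiv ℝ (𝔅 (κ k)) x - fderiv ℝ β x) := by
        simp only [hcp, Pi.sub_apply, map_sub, curlPairCLM_apply]
      rw [heq]
      exact (𝐋'[a, c]).le_opNorm _
    refine tendsto_of_tendsto_of_tendsto_of_le_of_le tendsto_const_nhds ?_ (fun _ => zero_le) hle
    have := (ENNReal.Tendsto.const_mul hκ43 (Or.inr ENNReal.coe_ne_top) : Tendsto (fun k =>
      (‖𝐋'[a, c]‖₊ : ℝ≥0∞) * eLpNorm (fun x => fderiv ℝ (𝔅 (κ k)) x - fderiv ℝ β x) (4 / 3) volume) atTop _)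
    rw [mul_zero] at this
    simpa [ENNReal.smul_def] using this
  have hR : Tendsto (fun k => ∫ x, ⟪v t x, cp (𝔅 (κ k)) x⟫) atTop (𝓝 (∫ x, ⟪v t x, cp β x⟫)) := by
    have h := tendsto_integral_bilin_of_tendsto_eLpNorm (p := 4) (q := 4 / 3) (innerSL ℝ (E := E)) h4
      (fun k => hcpm (h𝔅 (κ k))) (hcpm hβ) hcpconv
    exact h
  -- conclude
  have heq : (fun k => ∫ x, om (t, x) * 𝔅 (κ k) x) = fun k => ∫ x, ⟪v t x, cp (𝔅 (κ k)) x⟫ :=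
    funext fun k => ht (κ k)
  rw [heq] at hL
  exact tendsto_nhds_unique hL hR

end AllTests

/-! ### Assembly: the weak gradient in `L²(Q_T)` -/

section Gradient

/-- Slices of an `L^r` function on a product are a.e. in `L^r`. [folklore] -/
theorem ae_memLp_slice_of_memLp_prod {X Y : Type*} [MeasurableSpace X] [MeasurableSpace Y]
    {μ : Measure X} {κ : Measure Y} [SFinite μ] [SFinite κ] {G : Type*} [NormedAddCommGroup G]
    {f : X × Y → G} {r : ℝ≥0∞} (hr0 : r ≠ 0) (hrt : r ≠ ⊤) (hf : MemLp f r (μ.prod κ)) :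
    ∀ᵐ x ∂μ, MemLp (fun y => f (x, y)) r κ := by
  have hslice : ∀ᵐ x ∂μ, AEStronglyMeasurable (fun y => f (x, y)) κ := hf.1.prodMk_left
  have hfin := lintegral_rpow_enorm_lt_top_of_eLpNorm_lt_top hr0 hrt hf.2
  rw [lintegral_prod _ (hf.1.enorm.pow_const _)] at hfin
  have hint : AEMeasurable (fun x => ∫⁻ y, ‖f (x, y)‖ₑ ^ r.toReal ∂κ) μ :=
    (hf.1.enorm.pow_const _).lintegral_prod_right'
  have hfin' : ∀ᵐ x ∂μ, ∫⁻ y, ‖f (x, y)‖ₑ ^ r.toReal ∂κ < ⊤ := ae_lt_top' hint hfin.ne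
  filter_upwards [hslice, hfin'] with x h1 h2
  exact ⟨h1, (eLpNorm_lt_top_iff_lintegral_rpow_enorm_lt_top hr0 hrt).2 h2⟩

/-- The iterated lower integral of the squares of the slices of an `L²` function on the slab is
finite. [folklore] -/
theorem lintegral_lintegral_sq_lt_top_of_memLp_two {T : ℝ} {f : ℝ × E → ℝ}
    (hf : MemLp f 2 ((volume.restrict (Ioo 0 T)).prod (volume : Measure E))) :
    ∫⁻ t in Ioo 0 T, ENNReal.ofReal (∫ x, f (t, x) ^ 2) < ⊤ := by
  have hi : Integrable (fun p : ℝ × E => f p ^ 2) ((volume.restrict (Ioo 0 T)).prod (volume : Measure E)) :=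
    (memLp_two_iff_integrable_sq hf.1).1 hf
  have h := hi.integral_prod_left
  exact lt_of_le_of_lt (lintegral_mono fun t => Real.ofReal_le_enorm _) h.2

variable {ν T : ℝ} {v₀ : E → E} {v : ℝ → E → E}

/-- **The `L⁴(Q_T)` distributional solution has a square-integrable weak gradient** (the
`L²(0,T; H¹)` half of Galdi 2019, Thm. 1.1, in the tree's rendering of the Leray–Hopf class:
a weak gradient `G t` of `v t` for a.e. `t` with `∫₀ᵀ∫ |G|² < ∞`; dimension `3`). For `ν > 0`,
`T > 0`, `v` a weak solution with datum `v₀ ∈ L²` lying in `L⁴` of the slab, the weak vorticities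
`ω_{ij} ∈ L²(Q_T)` (`IsWeakNSSolutionOn.exists_weakVorticity_memLp_two`) slice for a.e. `t` into
weak vorticities of `v(t) ∈ L⁴` (`ae_forall_slice_weakVorticity_eq`), and the `div`–`curl`
argument (`exists_hasWeakGradient_of_weakVorticity`) gives `∇v(t) ∈ L²` with
`∫|∇v(t)|² ≤ ½ Σᵢⱼ ‖ω_{ij}(t)‖₂²`, which is integrable in `t`. [cite: Galdi2018, Thm 1.1] -/
theorem IsWeakNSSolutionOn.exists_weakGradient_of_L4 (h3 : Module.finrank ℝ E = 3) (hν : 0 < ν)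
    (hT : 0 < T) (hw : IsWeakNSSolutionOn T ν 0 v₀ v) (hv₀ : MemLp v₀ 2 volume)
    (hv4 : eLpNorm (uncurry v) 4 ((volume.restrict (Ioo 0 T)).prod (volume : Measure E)) < ⊤) :
    ∃ G : ℝ → E → E →L[ℝ] E,
      (∀ᵐ t ∂(volume.restrict (Ioo 0 T)), HasWeakGradient (v t) (G t)) ∧
      ∫⁻ t in Ioo 0 T, ∫⁻ x, ENNReal.ofReal (frobeniusNormSq (G t x)) < ⊤ := by
  classical
  set b := stdOrthonormalBasis ℝ E
  set μ : Measure (ℝ × E) := (volume.restrict (Ioo 0 T)).prod (volume : Measure E) with hμ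
  have hv : MemLp (uncurry v) 4 μ := ⟨aestronglyMeasurable_uncurry_prod_of_restrict hw.1, hv4⟩
  -- the weak vorticities
  have hex : ∀ i j : Fin (Module.finrank ℝ E), ∃ om : ℝ × E → ℝ, MemLp om 2 μ ∧
      ∀ θ : ℝ → E → ℝ, IsSpaceTimeTestOn (slab E (Ioo 0 T) isOpen_Ioo) θ →
        ∫ p, om p * θ p.1 p.2 ∂μ =
          ∫ p, ⟪v p.1 p.2, (fderiv ℝ (θ p.1) p.2 (b i)) • b j - (fderiv ℝ (θ p.1) p.2 (b j)) • b i⟫ ∂μ :=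
    fun i j => hw.exists_weakVorticity_memLp_two hν hT hv₀ hv4 (b i) (b j)
  choose om hom2 hid using hex
  -- a.e. slice facts
  have hv4ae : ∀ᵐ t ∂(volume.restrict (Ioo 0 T)), MemLp (v t) 4 (volume : Measure E) :=
    ae_memLp_slice_of_memLp_prod (by norm_num) (by norm_num) hv
  have hom2ae : ∀ i j, ∀ᵐ t ∂(volume.restrict (Ioo 0 T)), MemLp (fun x => om i j (t, x)) 2 (volume : Measure E) :=
    fun i j => ae_memLp_slice_of_memLp_prod two_ne_zero ENNReal.ofNat_ne_top (hom2 i j)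
  have hidae : ∀ i j, ∀ᵐ t ∂(volume.restrict (Ioo 0 T)), ∀ β : E → ℝ,
      FunctionSpaces.IsTestFunctionOn (⊤ : Opens E) β →
        ∫ x, om i j (t, x) * β x = ∫ x, ⟪v t x, (fderiv ℝ β x (b i)) • b j - (fderiv ℝ β x (b j)) • b i⟫ :=
    fun i j => ae_forall_slice_weakVorticity_eq hv (hom2 i j) (hid i j) hv4ae (hom2ae i j)
  have hdivae : ∀ᵐ t ∂(volume.restrict (Ioo 0 T)), IsWeaklyDivFree (v t) := hw.2.2.1
  -- the good times
  set P : ℝ → Prop := fun t => MemLp (v t) 4 (volume : Measure E) ∧ IsWeaklyDivFree (v t) ∧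
    (∀ i j, MemLp (fun x => om i j (t, x)) 2 (volume : Measure E)) ∧
    (∀ i j, ∀ φ : E → ℝ, FunctionSpaces.IsTestFunctionOn (⊤ : Opens E) φ →
      ∫ y, (fderiv ℝ φ y (b i) * ⟪v t y, b j⟫ - fderiv ℝ φ y (b j) * ⟪v t y, b i⟫) =
        ∫ y, om i j (t, y) * φ y) with hP
  have hPae : ∀ᵐ t ∂(volume.restrict (Ioo 0 T)), P t := by
    have h1 := ae_all_iff.2 fun i => ae_all_iff.2 fun j => hom2ae i j
    have h2 := ae_all_iff.2 fun i => ae_all_iff.2 fun j => hidae i j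
    filter_upwards [hv4ae, hdivae, h1, h2] with t ht4 htd ht2 htid
    refine ⟨ht4, htd, ht2, fun i j φ hφ => ?_⟩
    rw [htid i j φ hφ]
    refine integral_congr_ae (Eventually.of_forall fun y => ?_)
    dsimp only
    rw [inner_sub_right, real_inner_smul_right, real_inner_smul_right]
  -- the gradient field
  set G : ℝ → E → E →L[ℝ] E := fun t => if ht : P t then
    (exists_hasWeakGradient_of_weakVorticity h3 ht.1 ht.2.1 ht.2.2.1 ht.2.2.2).choose else 0 with hG
  have hGspec : ∀ t, P t → HasWeakGradient (v t) (G t) ∧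
      ∫⁻ x, ENNReal.ofReal (frobeniusNormSq (G t x)) ≤
        ENNReal.ofReal ((1 / 2) * ∑ i, ∑ j, ∫ y, om i j (t, y) ^ 2) := fun t ht => by
    have h := (exists_hasWeakGradient_of_weakVorticity h3 ht.1 ht.2.1 ht.2.2.1 ht.2.2.2).choose_spec
    simp only [hG, ht]
    exact h
  refine ⟨G, ?_, ?_⟩
  · filter_upwards [hPae] with t ht
    exact (hGspec t ht).1
  · -- the integrated bound
    have hle : ∫⁻ t in Ioo 0 T, ∫⁻ x, ENNReal.ofReal (frobeniusNormSq (G t x)) ≤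
        ∫⁻ t in Ioo 0 T, ∑ i, ∑ j, ENNReal.ofReal (∫ y, om i j (t, y) ^ 2) := by
      refine lintegral_mono_ae ?_
      filter_upwards [hPae] with t ht
      refine (hGspec t ht).2.trans ?_
      have h0 : ∀ i j, 0 ≤ ∫ y, om i j (t, y) ^ 2 := fun i j => integral_nonneg fun _ => sq_nonneg _
      calc ENNReal.ofReal ((1 / 2) * ∑ i, ∑ j, ∫ y, om i j (t, y) ^ 2)
          ≤ ENNReal.ofReal (∑ i, ∑ j, ∫ y, om i j (t, y) ^ 2) := by
            refine ENNReal.ofReal_le_ofReal ?_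
            have hs : 0 ≤ ∑ i, ∑ j, ∫ y, om i j (t, y) ^ 2 :=
              Finset.sum_nonneg fun i _ => Finset.sum_nonneg fun j _ => h0 i j
            linarith
        _ = ∑ i, ∑ j, ENNReal.ofReal (∫ y, om i j (t, y) ^ 2) := by
            rw [ENNReal.ofReal_sum_of_nonneg fun i _ => Finset.sum_nonneg fun j _ => h0 i j]
            exact Finset.sum_congr rfl fun i _ => ENNReal.ofReal_sum_of_nonneg fun j _ => h0 i j
    refine lt_of_le_of_lt hle ?_
    have hmeas : ∀ i j, AEMeasurable (fun t => ENNReal.ofReal (∫ y, om i j (t, y) ^ 2))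
        (volume.restrict (Ioo 0 T)) := fun i j => by
      have h : AEStronglyMeasurable (fun p : ℝ × E => om i j p ^ 2) μ := (hom2 i j).1.pow 2
      exact h.integral_prod_right'.aemeasurable.ennreal_ofReal
    rw [lintegral_finsetSum' (f := fun i t => ∑ j, ENNReal.ofReal (∫ y, om i j (t, y) ^ 2)) Finset.univ
      fun i _ => Finset.aemeasurable_fun_sum Finset.univ fun j _ => hmeas i j]
    refine ENNReal.sum_lt_top.2 fun i _ => ?_
    rw [lintegral_finsetSum' (f := fun j t => ENNReal.ofReal (∫ y, om i j (t, y) ^ 2)) Finset.univ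
      fun j _ => hmeas i j]
    exact ENNReal.sum_lt_top.2 fun j _ => lintegral_lintegral_sq_lt_top_of_memLp_two (hom2 i j)

end Gradient






end Literature.Analysis.FluidPDE
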